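import Summits.CriticalPhenomena.SAWScalingLimit.Theses.SAWAsymptoticMorera
import Summits.CriticalPhenomena.SAWScalingLimit.Theorems.SAWRenewalTightnessTightIdentificationGlue

/-!
# `SAWAsymptoticMorera.Assembly` (stmt-CriticalPhenomena-7797): the Prokhorov glue of the route

Closes the assembly item of route `SAWAsymptoticMorera` of the sub-problem `SAWScalingLimit`:

  `Assembly := AsymptoticMorera → InteriorRegularity → BoundaryIdentification →
    SubseqIdentification → (eventual tightness `IsTightAlongMesh` of the critical SAW laws for
    every Dobrushin domain and endpoint approximation, the inlined statement of the shared crux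
    stmt-CriticalPhenomena-1881) → SAWScalingLimit`.

Proof (`sawAsymptoticMorera_assembly_proof`): the first three hypotheses (the observable engine
of the route) are consumed vacuously. For a Dobrushin domain `D` and an endpoint approximation
`(a, b)`, the tightness hypothesis gives `IsTightAlongMesh` of the pushed critical SAW laws, and
`SubseqIdentification`, read through `IsSubseqLimitLaw`, identifies every subsequential weak
limit law which is a probability measure as the chordal SLE_{8/3} law in `D`. The tree's PROVED
soft half `saw_convergesInLawToSLE_of_isTightAlongMesh`
(`SAWRenewalTightnessTightIdentificationGlue.lean`: Prokhorov's theorem + the subsequence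
principle along `𝓝[>] 0` + uniqueness of the chordal SLE law, using that
`SAW.law D.carrier δ (a δ) (b δ)` is a probability measure for all small `δ` and that the curve
map is a.e.-measurable) then gives `ConvergesInLawToSLE (8/3) D` for the SAW curve laws, which is
`SAWScalingLimit` unfolded. No named fact is used; axioms are the standard three.

References: P. Billingsley, *Convergence of Probability Measures* (1999), Thm. 5.1 and its
Corollary; H. Duminil-Copin, S. Smirnov, *Conformal invariance of lattice models* (2012), proof
of Thm. 3.13.
-/

noncomputable section

open MeasureTheory Filter Topology Set
open Literature.Probability.RandomPlanarGeometry Literature.Probability.LatticeModels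

namespace Summit.CriticalPhenomena.SAWScalingLimit.Theorems

/-- **Assembly of route SAWAsymptoticMorera** (item stmt-CriticalPhenomena-7797):
`AsymptoticMorera → InteriorRegularity → BoundaryIdentification → SubseqIdentification →
(eventual tightness along the mesh of the critical SAW laws) → SAWScalingLimit`.
The observable hypotheses are not needed for the glue; eventual tightness (`IsTightAlongMesh`)
of the critical SAW curve laws together with the identification of the subsequential limit laws
as the chordal SLE_{8/3} law yields, by the proved soft half
`saw_convergesInLawToSLE_of_isTightAlongMesh` (Prokhorov + subsequence principle + uniqueness of
the SLE_{8/3} law), convergence in law to chordal SLE_{8/3} for every Dobrushin domain and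
endpoint approximation, i.e. `SAWScalingLimit`. [folklore] -/
theorem sawAsymptoticMorera_assembly_proof :
    Summit.CriticalPhenomena.SAWScalingLimit.Theses.SAWAsymptoticMorera.Assembly := by
  unfold Summit.CriticalPhenomena.SAWScalingLimit.Theses.SAWAsymptoticMorera.Assembly
  intro _ _ _ hI hT D a b hab
  refine saw_convergesInLawToSLE_of_isTightAlongMesh hab (hT D a b hab) ?_
  rintro μ hμ ⟨s, hs, hlim⟩
  exact hI D a b hab s μ hs hμ hlim

end Summit.CriticalPhenomena.SAWScalingLimit.Theorems

end
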